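/-
Copyright (c) 2026 the pub-hodgecm-mathlib formalisation cell (harness21).  Prover seat hodgecm-mathlib-LH4-p12 (g7), req620 Track A «(D-RAM) FOUR-FRAME», line LH4
(STAGE-1b tier-0 regular row, (L-sq) labelled trunk organ (e1) of the (T-box | sq) SPEC `F0/P3c/LH4/LH4-p12/g7/tbox/TBOX-SQ-SPEC.v1.LH4p12g7.md` §1: the DERIVED FENCE of the
square element datum — the depths of `(a², b²)` under the root guard exceed `2·v(2)`, and `v(2) ≥ d − 1` — so `nᵢ ≥ 2d − 1`, the hypothesis under which the truncated
κ-box-sum of the square law equals `amplSq`).  2026-09-04.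
-/
import Literature.NumberTheory.LocalFields.WildQuadraticDatumTraceBound   -- ★ `trace_bound_pow_of_isRamifiedQuadraticDatum` (the different bound)
import Literature.NumberTheory.Automorphic.UnitaryThreeFourFrameDefs      -- ★ `IsRamifiedQuadraticDatum`, `IsElementDatum`, `depthOfRecord`
import Literature.NumberTheory.LocalFields.CayleyLevelShift            -- ★ `valued_add_one_eq_two` (`|y − 1| < |2| ⇒ |y + 1| = |2|`)
import HarnessLib

/-!
# Crux `H413`, line LH4 «(D-RAM) FOUR-FRAME» — (e1) THE DERIVED FENCE OF THE SQUARE ELEMENT DATUM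

The labelled signed κ-Stage B₀ of the square law (`hBκS0sq` of ★ p859556 ∕ ★ p859650) quantifies over a wild datum (`IsRamifiedQuadraticDatum σ ϖ d t`, `|2| < 1`), norm-one
roots `a, b` under the ROOT GUARD `|a − 1|, |b − 1| < |2|`, and a square element datum `IsElementDatum σ ϖ (depthOfRecord d) (a²) (b²) n₁ n₂ n₃`.  The (T-box | sq) SPEC
sweep shows that the truncated κ-box-sum equals `amplSq` exactly under the fence `nᵢ ≥ 2d − 1` — and fails at (unrealizable) shallower keys.  This file derives that fence from
the binders, once, for the (T-box)∕(T-asm) hands: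

* `v_mul_self_sub_one_lt` — under the root guard `|a + 1| = |2|` (★ Lit `valued_add_one_eq_two`), so `|a² − 1| = |a − 1|·|2| < |2|²`; `v_sq_sub_sq_lt` — `|a² − b²| < |2|²` likewise.
* `two_mul_t_lt_depths_of_rootGuard` — `2t < n₁ ∧ 2t < n₂ ∧ 2t < n₃` for the square datum.
* `d_le_t_add_one` — `d ≤ t + 1` (★ different bound at `a = 1`: `|2| = |1 + σ1| ≤ |ϖ|^{d−1}`).
* HEAD `depths_ge_of_rootGuard` — `2d ≤ n₁ + 1 ∧ 2d ≤ n₂ + 1 ∧ 2d ≤ n₃ + 1`.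

HONEST LABEL: helper lane (`--supports stmt-HodgeConjecture-24833`), count-neutral valuation arithmetic; pays no tier-0 row (T₊∕T₋∕reg OPEN; labelled trunk OPEN = (c) T-box + (d)
T-asm); HC_CM is proved only modulo the 7 printed citations (2 remaining named inputs: hLiu418 = stmt-HodgeConjecture-24832, h413 = stmt-HodgeConjecture-24833) until rung 0 closes.

## References (NEVER `[KR2]`)
* [Serre1979] J.-P. Serre, *Local Fields*, GTM 67 (1979), Ch. III §3 Prop. 7 (the different of a wildly ramified quadratic extension), Ch. V §3.
* [Rogawski1990] J. D. Rogawski, *Automorphic Representations of Unitary Groups in Three Variables*, Ann. of Math. Stud. 123 (1990), §4.9 p. 55 (root depths of norm-one elements).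
-/

set_option autoImplicit false

noncomputable section

namespace Summit.HodgeConjecture.HodgeConjecture.Cruxes.H413.F0P3cDyRamSqDatumDerivedFence

open Literature.NumberTheory.Automorphic Literature.NumberTheory.Automorphic.UnitaryThreeFourFrame
open Literature.NumberTheory.LocalFields Literature.NumberTheory.LocalFields.WildQuadraticDatum
open scoped Valued WithZero

variable {K : Type} [Field K] [Valued K ℤᵐ⁰]

/-! ## §1  Root-guard valuation arithmetic -/

/-- Under the root guard: `|a·a − 1| = |a − 1|·|2| < |2|·|2|`. [cite: Serre1979, Ch. V §3] -/
theorem v_mul_self_sub_one_lt {a : K} (ha : Valued.v (a - 1) < Valued.v (2 : K)) (h2 : Valued.v (2 : K) ≠ 0) :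
    Valued.v (a * a - 1) < Valued.v (2 : K) * Valued.v (2 : K) := by
  rw [show a * a - 1 = (a - 1) * (a + 1) by ring, map_mul, valued_add_one_eq_two ha]
  exact mul_lt_mul_of_pos_right ha (zero_lt_iff.2 h2)

/-- Under both root guards: `|a·a − b·b| < |2|·|2|` (`a² − b² = (a − b)(a + b)`, `|a − b| ≤ max(|a−1|,|b−1|) < |2|`, `|a + b| = |2|`). [cite: Serre1979, Ch. V §3] -/
theorem v_sq_sub_sq_lt {a b : K} (ha : Valued.v (a - 1) < Valued.v (2 : K)) (hb : Valued.v (b - 1) < Valued.v (2 : K)) (h2 : Valued.v (2 : K) ≠ 0) :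
    Valued.v (a * a - b * b) < Valued.v (2 : K) * Valued.v (2 : K) := by
  have hab : Valued.v (a - b) < Valued.v (2 : K) := by
    rw [show a - b = (a - 1) - (b - 1) by ring]
    exact lt_of_le_of_lt (Valuation.map_sub _ _ _) (max_lt ha hb)
  have hapb : Valued.v (a + b) = Valued.v (2 : K) := by
    rw [show a + b = 2 + ((a - 1) + (b - 1)) by ring]
    have hlt : Valued.v ((a - 1) + (b - 1)) < Valued.v (2 : K) := lt_of_le_of_lt (Valuation.map_add _ _ _) (max_lt ha hb)
    exact Valuation.map_add_eq_of_lt_left _ hlt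
  rw [show a * a - b * b = (a - b) * (a + b) by ring, map_mul, hapb]
  exact mul_lt_mul_of_pos_right hab (zero_lt_iff.2 h2)

/-! ## §2  The fence in exponents -/

/-- From `|ϖ|^n < |ϖ|^m` with `|ϖ| ≤ 1`: `m < n`. -/
theorem lt_of_pow_lt_pow {ϖ : K} (hϖ1 : Valued.v ϖ ≤ 1) {n m : ℕ} (h : Valued.v ϖ ^ n < Valued.v ϖ ^ m) : m < n := by
  by_contra hle
  exact absurd (pow_le_pow_right_of_le_one' hϖ1 (not_lt.1 hle)) (not_le.2 h)

/-- **THE SQUARE DEPTHS EXCEED `2·v(2)`**: for a wild datum and a square element datum `(a², b²; n₁, n₂, n₃)` under the root guards, `2t < n₁ ∧ 2t < n₂ ∧ 2t < n₃`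
(`|a² − 1| = |a − 1|·|2| < |2|² = |ϖ|^{2t}`, etc.). [cite: Rogawski1990, §4.9 p. 55] [cite: Serre1979, Ch. V §3] -/
theorem two_mul_t_lt_depths_of_rootGuard {σ : K →+* K} {ϖ : K} {d t : ℕ} (hD : IsRamifiedQuadraticDatum σ ϖ d t)
    {a b : K} (ha : Valued.v (a - 1) < Valued.v (2 : K)) (hb : Valued.v (b - 1) < Valued.v (2 : K))
    {N₀ n₁ n₂ n₃ : ℕ} (hE : IsElementDatum σ ϖ N₀ (a * a) (b * b) n₁ n₂ n₃) :
    2 * t < n₁ ∧ 2 * t < n₂ ∧ 2 * t < n₃ := by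
  obtain ⟨-, -, hϖ, -, -, -, h2t⟩ := hD
  obtain ⟨-, -, -, -, -, h₁, h₂, h₃, -, -, -⟩ := hE
  have hϖ1 : Valued.v ϖ ≤ 1 := by rw [hϖ, ← WithZero.exp_zero, WithZero.exp_le_exp]; norm_num
  have hϖ0 : Valued.v ϖ ≠ 0 := by rw [hϖ]; exact WithZero.exp_ne_zero
  have h20 : Valued.v (2 : K) ≠ 0 := by rw [h2t]; exact pow_ne_zero _ hϖ0
  have h22 : Valued.v (2 : K) * Valued.v (2 : K) = Valued.v ϖ ^ (2 * t) := by rw [h2t, ← pow_add]; congr 1; ring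
  refine ⟨lt_of_pow_lt_pow hϖ1 ?_, lt_of_pow_lt_pow hϖ1 ?_, lt_of_pow_lt_pow hϖ1 ?_⟩
  · rw [← h₁, ← h22]; exact v_mul_self_sub_one_lt hb h20
  · rw [← h₂, ← h22]; exact v_mul_self_sub_one_lt ha h20
  · rw [← h₃, ← h22]; exact v_sq_sub_sq_lt ha hb h20

/-- **`d ≤ t + 1`**: the different bound ★ `trace_bound_pow_of_isRamifiedQuadraticDatum` at `a = 1` reads `|2| = |1 + σ1| ≤ |ϖ|^{d−1}`, i.e. `|ϖ|^t ≤ |ϖ|^{d−1}`.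
[cite: Serre1979, Ch. III §3 Prop. 7] -/
theorem d_le_t_add_one {σ : K →+* K} {ϖ : K} {d t : ℕ} (hD : IsRamifiedQuadraticDatum σ ϖ d t) : d ≤ t + 1 := by
  have h := trace_bound_pow_of_isRamifiedQuadraticDatum hD 1
  obtain ⟨-, -, hϖ, -, -, -, h2t⟩ := hD
  rw [map_one, map_one, mul_one, show (1 : K) + 1 = 2 by norm_num, h2t] at h
  have hϖlt : Valued.v ϖ < 1 := by rw [hϖ, ← WithZero.exp_zero, WithZero.exp_lt_exp]; norm_num
  have hϖ0 : 0 < Valued.v ϖ := by rw [hϖ]; exact WithZero.exp_pos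
  by_contra hlt
  have hlt' : t < d - 1 := by omega
  have : Valued.v ϖ ^ (d - 1) < Valued.v ϖ ^ t := pow_lt_pow_right_of_lt_one₀ hϖ0 hϖlt hlt'
  exact absurd h (not_le.2 this)

/-- **HEAD — THE DERIVED FENCE `nᵢ ≥ 2d − 1`** of the square element datum under the root guards (the hypothesis of the truncated κ-box-sum of the square law): `2d ≤ n₁ + 1`,
`2d ≤ n₂ + 1`, `2d ≤ n₃ + 1` — from `2t < nᵢ` and `d ≤ t + 1`. [cite: Rogawski1990, §4.9 p. 55] [cite: Serre1979, Ch. III §3 Prop. 7] -/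
theorem depths_ge_of_rootGuard {σ : K →+* K} {ϖ : K} {d t : ℕ} (hD : IsRamifiedQuadraticDatum σ ϖ d t)
    {a b : K} (ha : Valued.v (a - 1) < Valued.v (2 : K)) (hb : Valued.v (b - 1) < Valued.v (2 : K))
    {N₀ n₁ n₂ n₃ : ℕ} (hE : IsElementDatum σ ϖ N₀ (a * a) (b * b) n₁ n₂ n₃) :
    2 * d ≤ n₁ + 1 ∧ 2 * d ≤ n₂ + 1 ∧ 2 * d ≤ n₃ + 1 := by
  obtain ⟨h1, h2, h3⟩ := two_mul_t_lt_depths_of_rootGuard hD ha hb hE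
  have hdt := d_le_t_add_one hD
  exact ⟨by omega, by omega, by omega⟩

end Summit.HodgeConjecture.HodgeConjecture.Cruxes.H413.F0P3cDyRamSqDatumDerivedFence

end
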